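import Literature.NumberTheory.ComplexMultiplication.InfinityTypesModTwo
import Literature.NumberTheory.ComplexMultiplication.TaniyamaDefectTrivial
import HarnessLib

/-!
# «`e_ρ̄` depends only on the weight, and so `e_Φ(σ)` depends only on `σ`»: the weight bookkeeping of Milne's §4.4 for
# a Taniyama defect (Milne, *The fundamental theorem of complex multiplication*, arXiv:0705.3446, §4.4)

Topic `NumberTheory/ComplexMultiplication`; namespace `Literature.NumberTheory.ComplexMultiplication`.  Lane `lit-hodgefound`
(Track 2, Layer A3 skeleton seat `skel-3`, row A3-G50, FILE 2 of 2; FILE 1 = `…/InfinityTypesModTwo`, the `G`-set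
level).  THEOREMS ONLY (no definition, no named fact, no instance; D-0026, net debt 0), in the vocabulary of rows
A3-G45 – A3-G49: `K` a CM field (Milne's `E`; `K⁺ = maximalRealSubfield K` is Milne's `F`), `c ∈ Γ_ℚ` a complex
conjugation, `X = Γ_ℚ ⧸ res(Γ_K)` (`= Hom(E, ℚ̄)`), CM types `Ψ ⊆ X` with `IsCMTypeWith c Ψ`,
`Q = 𝔸^×_{K,f}/K^×` with the automorphisms `finiteClassGal K α` (`α ∈ Aut(K)`), and a TANIYAMA DEFECT
`e : Set X → Γ_ℚ → Q` (`IsTaniyamaDefect K c e`, row A3-G48 = Milne's Prop. 4.13 (a)–(e) for `e_Φ = g_Φ/f_Φ`).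

## The print, verbatim

J. S. Milne, arXiv:0705.3446 [Milne2007FundamentalCM], §4.4 (held `paper:arxiv-0705.3446` p0022 L62–L150):

> «(g) denote by `[Φ]` the characteristic function of `Φ ⊂ Hom(E, ℂ)`; then `∑_i n_i[Φ_i] = 0 ⟹ ∏_i e_{Φ_i}(σ)^{n_i} = 1`
> for all `σ ∈ Aut(ℂ)`. […] Now (g) allows us to define `e_ρ` by linearity for `ρ` an infinity type on `E`.  Moreover,
> `e_{2ρ} = e_ρ² = 0`, so that `e_ρ` depends only on the reduction modulo `2` of `ρ` […] We now prove that `e_ρ̄ = 1` if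
> `ρ̄` is of weight `0`. […] When `E` is a subfield of `ℂ` Galois over `ℚ`, (b) implies that there exists an
> `e(σ) ∈ μ₂(𝔸_{f,F})/μ₂(F)` such that `e_q(σ) = ∏_{φ : F → ℂ} φ⁻¹(e(σ))^{q(φ)}` [footnote: «we can take
> `e(σ) = e_{1+ι}(σ)`»] […] It follows from (f), that for any totally real field `F′` containing `F`,
> `e^F(σ) = Nm_{F′/F} e^{F′}(σ)`. […] Therefore `e_q(σ)` projects to zero in `μ₂(F_{ℓ₁} × F_{ℓ₂})/μ₂(F)`.  This being true
> for every pair `(ℓ₁, ℓ₂)`, we have `e_q = 1`.  We now complete the proof of (4.16).  We know that `e_ρ̄` depends only on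
> the weight of `ρ̄`, and so, for `Φ` a CM-type, `e_Φ(σ)` depends only on `σ`.»

## What is formalised (and what is axiomatised)

Fix `σ ∈ Γ_ℚ`.  The function `Ψ ↦ e_Ψ(σ)` on CM types, written additively in `Additive Q`, is the `e` of FILE 1; Prop.
4.14 («`e_Φ(σ)² = 1`», row A3-G48 `IsTaniyamaDefect.sq_eq_one`) is FILE 1's `2e = 0`; Milne's (g) is the hypothesis
`RespectsRelations c (fun Ψ => Additive.ofMul (e Ψ σ))`; Milne's `(1+ι)x`-value `e_{(1+ι)x}(σ)` is the PAIR DEFECT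
`e_Ψ(σ)/e_{Ψ ∆ {x, cx}}(σ)` (independent of `Ψ` under (g), FILE 1).  The geometric inputs (f), (g) (abelian varieties
`A ⊗_E E′`; Deligne's absolute Hodge cycles on CM motives) stay hypotheses: (g) verbatim, and (f) through its only use,
the NORM PROPERTY of the sign representatives of the pair defect (as in row A3-G49).

* §1 The `(g)`-free mechanism: a defect invariant under every pair flip of every CM type is constant in the type
  (`apply_eq_apply_of_forall_symmDiff_pair`); `2 • e_Ψ(σ) = 0` additively.
* §2 Under (g): the pair defect does not depend on the reference type (`div_apply_symmDiff_pair_eq`), the infinity-type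
  extension `ẽ_σ` and its reduction `ē_σ` (FILE 1's `linearExtension` / `modTwoExtension`) exist for `e_σ`, and **«`e_ρ̄`
  depends only on the weight ⟹ `e_Φ(σ)` depends only on `σ`»**: if the pair defects `e_{Ψ₀}(σ)/e_{Ψ₀ ∆ {x,cx}}(σ)` at one
  reference type are trivial then `e_Ψ(σ) = e_{Ψ′}(σ)` for all CM types (`apply_eq_apply_of_forall_pair`), and `ē_σ`
  takes equal values on classes of equal weight (`modTwoExtension_eq_of_weightModTwo_eq`).
* §3 Milne's use of (b) for `E` Galois: with «`e_{Φ(τ⁻¹|E)}(σ) = τ e_Φ(σ)`» for all `τ ∈ Γ_ℚ` (row A3-G47's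
  `translateType`, `finiteClassGal`, `absGaloisQuot`), ONE trivial pair defect (at the base point `1·res(Γ_K)`, Milne's
  `e_{1+ι}(σ)`) suffices (`apply_eq_apply_of_pair_base_of_isGalois`).
* §4 The junction with row A3-G49: the pair defect is represented by a SIGN IDÈLE of `F = K⁺` (product of the sign
  representatives of row A3-G48 §6); if these representatives have the norm property from every totally real quadratic
  `M/F` («`e^F(σ) = Nm_{F′/F} e^{F′}(σ)`», Milne's consequence of (f)) the pair defect is trivial (the
  `(ℓ₁, ℓ₂)`-argument, `exists_eq_unitEmbedding_of_forall_quadratic_mk`); assembled: **`apply_eq_apply_of_norm_property`**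
  (every point) and **`apply_eq_apply_of_norm_property_of_isGalois`** (the base point only, `K/ℚ` Galois).

NOT HERE (Layer B): (f) and (g) as theorems; the passage from «`e_Φ(σ)` depends only on `σ`» to `e = 1` through
`E ⊂ E·ℚ(√−1)` (needs (f) across fields); Theorems 4.1/4.2.

## References

* J. S. Milne, *The fundamental theorem of complex multiplication*, arXiv:0705.3446 (2007), §4.3 Props. 4.13–4.14, §4.4.
  [Milne2007FundamentalCM]
* P. Deligne, *Motifs et groupes de Taniyama*, LNM 900 (1982), (F.5)–(F.6). [Deligne1982MotifsTaniyama]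

## Provenance

Lane `lit-hodgefound`, seat `literature-prover-lit-hodgefound-skel-3-g34-0` (row A3-G50, FILE 2).
-/

noncomputable section

open scoped Pointwise symmDiff
open Field NumberField IsDedekindDomain

namespace Literature.NumberTheory.ComplexMultiplication

open Literature.NumberTheory.GaloisRepresentations Literature.NumberTheory.NumberFields
open Literature.NumberTheory.AdelicBaseChange
open HalfTransfer

namespace IsTaniyamaDefect

variable {K : Type} [Field K] [NumberField K] [IsCMField K] {c : absoluteGaloisGroup ℚ}
  {e : Set (absoluteGaloisGroup ℚ ⧸ (absGaloisRestrict ℚ K).range) → absoluteGaloisGroup ℚ →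
    (FiniteAdeleRing (𝓞 K) K)ˣ ⧸ (FiniteAdeleRing.unitEmbedding (𝓞 K) K).range}
  (he : IsTaniyamaDefect K c e)
include he

/-! ### §1. The additive dictionary and the `(g)`-free mechanism -/

/-- **Prop. 4.14 additively: `2 • e_Ψ(σ) = 0` in `Additive Q`** («`e_Φ(σ)² = 1`», row A3-G48 `sq_eq_one`) — FILE 1's
hypothesis `2e = 0`. [cite: Milne2007FundamentalCM, §4.3 Prop. 4.14, §4.4 («e_{2ρ} = e_ρ² = 0»)] -/
theorem two_smul_ofMul_apply {Ψ : Set (absoluteGaloisGroup ℚ ⧸ (absGaloisRestrict ℚ K).range)} (hΨ : IsCMTypeWith c Ψ)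
    (σ : absoluteGaloisGroup ℚ) : 2 • Additive.ofMul (e Ψ σ) = 0 := by
  rw [← ofMul_pow, he.sq_eq_one hΨ σ, ofMul_one]

/-- The same for all CM types at once, in the form FILE 1 consumes. [cite: Milne2007FundamentalCM, §4.3 Prop. 4.14] -/
theorem forall_two_smul_ofMul_apply (σ : absoluteGaloisGroup ℚ) :
    ∀ Ψ : Set (absoluteGaloisGroup ℚ ⧸ (absGaloisRestrict ℚ K).range), IsCMTypeWith c Ψ →
      2 • (fun Φ => Additive.ofMul (e Φ σ)) Ψ = 0 :=
  fun _ hΨ => he.two_smul_ofMul_apply hΨ σ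

omit [IsCMField K] he in
/-- **The `(g)`-free mechanism**: a family `e` whose value `e_Ψ(σ)` is unchanged by every pair flip `Ψ ↦ Ψ ∆ {x, cx}` of
every CM type takes the same value on all CM types — «for `Φ` a CM-type, `e_Φ(σ)` depends only on `σ`» (FILE 1's
`eq_of_forall_symmDiff_pair_eq` on the finite `X = Γ_ℚ ⧸ res(Γ_K)`). [cite: Milne2007FundamentalCM, §4.4 (conclusion)] -/
theorem apply_eq_apply_of_forall_symmDiff_pair (σ : absoluteGaloisGroup ℚ)
    (hall : ∀ Ψ : Set (absoluteGaloisGroup ℚ ⧸ (absGaloisRestrict ℚ K).range), IsCMTypeWith c Ψ →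
      ∀ x : absoluteGaloisGroup ℚ ⧸ (absGaloisRestrict ℚ K).range, e (Ψ ∆ {x, c • x}) σ = e Ψ σ)
    {Ψ Ψ' : Set (absoluteGaloisGroup ℚ ⧸ (absGaloisRestrict ℚ K).range)} (hΨ : IsCMTypeWith c Ψ)
    (hΨ' : IsCMTypeWith c Ψ') : e Ψ σ = e Ψ' σ :=
  eq_of_forall_symmDiff_pair_eq (fun Φ => e Φ σ) hall hΨ hΨ'

/-! ### §2. Under (g): pair defects, `ẽ_σ`, `ē_σ`, and «`e_Φ(σ)` depends only on `σ`» -/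

section WithG

variable {σ : absoluteGaloisGroup ℚ} (hg : RespectsRelations c (fun Ψ => Additive.ofMul (e Ψ σ)))
  {Ψ₀ : Set (absoluteGaloisGroup ℚ ⧸ (absGaloisRestrict ℚ K).range)} (hΨ₀ : IsCMTypeWith c Ψ₀)
include hg hΨ₀

/-- **Milne's `e_{(1+ι)x}(σ)` is well defined**: under (g) the pair defect `e_Ψ(σ)/e_{Ψ ∆ {x, cx}}(σ)` does not depend on
the CM type `Ψ` (FILE 1 `sub_symmDiff_pair_eq_sub_symmDiff_pair`). [cite: Milne2007FundamentalCM, §4.4 (footnote: «e_{(1+ι)φ}(σ)»)] -/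
theorem div_apply_symmDiff_pair_eq {Ψ : Set (absoluteGaloisGroup ℚ ⧸ (absGaloisRestrict ℚ K).range)}
    (hΨ : IsCMTypeWith c Ψ) (x : absoluteGaloisGroup ℚ ⧸ (absGaloisRestrict ℚ K).range) :
    e Ψ σ / e (Ψ ∆ {x, c • x}) σ = e Ψ₀ σ / e (Ψ₀ ∆ {x, c • x}) σ := by
  classical
  haveI := Fintype.ofFinite (absoluteGaloisGroup ℚ ⧸ (absGaloisRestrict ℚ K).range)
  have h := hΨ₀.sub_symmDiff_pair_eq_sub_symmDiff_pair (G := absoluteGaloisGroup ℚ) hg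
    (he.forall_two_smul_ofMul_apply σ) hΨ hΨ₀ x
  apply Additive.ofMul.injective
  rw [ofMul_div, ofMul_div]
  exact h

/-- **«`e_ρ̄` depends only on the weight of `ρ̄`, and so, for `Φ` a CM-type, `e_Φ(σ)` depends only on `σ`»** — the
K-level form: if `e` satisfies (g) at `σ` and every pair defect at the reference type `Ψ₀` is trivial
(`e_{Ψ₀ ∆ {x, cx}}(σ) = e_{Ψ₀}(σ)`, i.e. `e_{(1+ι)x}(σ) = 1` for all `x` — «`e_q = 1`»), then `e_Ψ(σ) = e_{Ψ′}(σ)` for all CM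
types `Ψ, Ψ′`. [cite: Milne2007FundamentalCM, §4.4 (conclusion)] -/
theorem apply_eq_apply_of_forall_pair
    (hpair : ∀ x : absoluteGaloisGroup ℚ ⧸ (absGaloisRestrict ℚ K).range, e (Ψ₀ ∆ {x, c • x}) σ = e Ψ₀ σ)
    {Ψ Ψ' : Set (absoluteGaloisGroup ℚ ⧸ (absGaloisRestrict ℚ K).range)} (hΨ : IsCMTypeWith c Ψ)
    (hΨ' : IsCMTypeWith c Ψ') : e Ψ σ = e Ψ' σ := by
  classical
  haveI := Fintype.ofFinite (absoluteGaloisGroup ℚ ⧸ (absGaloisRestrict ℚ K).range)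
  have h := hΨ₀.apply_eq_apply_of_forall_pair (G := absoluteGaloisGroup ℚ) hg (he.forall_two_smul_ofMul_apply σ)
    (fun x => congrArg Additive.ofMul (hpair x)) hΨ hΨ'
  exact Additive.ofMul.injective h

/-- **«`e_ρ̄` depends only on the weight of `ρ̄`»** for `ē_σ = modTwoExtension` (FILE 1) of `Ψ ↦ e_Ψ(σ)`: under (g) and
trivial pair defects at `Ψ₀`, two classes of `Ī(X)` with the same weight modulo `2` have the same `ē_σ`.
[cite: Milne2007FundamentalCM, §4.4 («We know that e_ρ̄ depends only on the weight of ρ̄»)] -/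
theorem modTwoExtension_eq_of_weightModTwo_eq
    [Fintype (absoluteGaloisGroup ℚ ⧸ (absGaloisRestrict ℚ K).range)]
    (hpair : ∀ x : absoluteGaloisGroup ℚ ⧸ (absGaloisRestrict ℚ K).range, e (Ψ₀ ∆ {x, c • x}) σ = e Ψ₀ σ)
    (x₀ : absoluteGaloisGroup ℚ ⧸ (absGaloisRestrict ℚ K).range)
    {ρ ρ' : infinityTypesModTwo (absoluteGaloisGroup ℚ) (absoluteGaloisGroup ℚ ⧸ (absGaloisRestrict ℚ K).range) c}
    (hw : weightModTwo c x₀ (ρ : _ → ZMod 2) = weightModTwo c x₀ (ρ' : _ → ZMod 2)) :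
    hΨ₀.modTwoExtension (G := absoluteGaloisGroup ℚ) hg (he.forall_two_smul_ofMul_apply σ) ρ =
      hΨ₀.modTwoExtension (G := absoluteGaloisGroup ℚ) hg (he.forall_two_smul_ofMul_apply σ) ρ' := by
  classical
  exact hΨ₀.modTwoExtension_eq_of_weightModTwo_eq hg (he.forall_two_smul_ofMul_apply σ) x₀
    ((hΨ₀.forall_weightZero_eq_zero_iff_pair hg (he.forall_two_smul_ofMul_apply σ) x₀).2
      fun x => congrArg Additive.ofMul (hpair x)) hw

end WithG

/-! ### §3. Milne's use of (b) for `E` Galois over `ℚ`: one pair class suffices -/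

section Galois

variable {σ : absoluteGaloisGroup ℚ} (hg : RespectsRelations c (fun Ψ => Additive.ofMul (e Ψ σ)))
  {Ψ₀ : Set (absoluteGaloisGroup ℚ ⧸ (absGaloisRestrict ℚ K).range)} (hΨ₀ : IsCMTypeWith c Ψ₀)
include hg hΨ₀

/-- **«When `E` is … Galois over `ℚ`, (b) implies that there exists an `e(σ)` such that
`e_q(σ) = ∏_{φ : F → ℂ} φ⁻¹(e(σ))^{q(φ)}` — we can take `e(σ) = e_{1+ι}(σ)`»**: for `K/ℚ` Galois and a defect
satisfying (g) at `σ` and the printed (b) «`e_{Φ(τ⁻¹|E)}(σ) = τ e_Φ(σ)`» for every `τ ∈ Γ_ℚ` (`τ` acts on `K` as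
`τ̄ = absGaloisQuot ℚ K τ`, on `Q` as `finiteClassGal K τ̄`, on types as `translateType τ`), the triviality of the ONE pair
defect at the base point `1·res(Γ_K)` (Milne's `1 + ι`) gives `e_Ψ(σ) = e_{Ψ′}(σ)` for all CM types.
[cite: Milne2007FundamentalCM, §4.4] -/
theorem apply_eq_apply_of_pair_base_of_isGalois [IsGalois ℚ K]
    (hb : ∀ (τ : absoluteGaloisGroup ℚ) (Ψ : Set (absoluteGaloisGroup ℚ ⧸ (absGaloisRestrict ℚ K).range)),
      IsCMTypeWith c Ψ → e (translateType τ Ψ) σ = finiteClassGal K (absGaloisQuot ℚ K τ) (e Ψ σ))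
    (h1 : e (Ψ₀ ∆ {((1 : absoluteGaloisGroup ℚ) : absoluteGaloisGroup ℚ ⧸ (absGaloisRestrict ℚ K).range),
      c • ((1 : absoluteGaloisGroup ℚ) : absoluteGaloisGroup ℚ ⧸ (absGaloisRestrict ℚ K).range)}) σ = e Ψ₀ σ)
    {Ψ Ψ' : Set (absoluteGaloisGroup ℚ ⧸ (absGaloisRestrict ℚ K).range)} (hΨ : IsCMTypeWith c Ψ)
    (hΨ' : IsCMTypeWith c Ψ') : e Ψ σ = e Ψ' σ := by
  classical
  haveI := Fintype.ofFinite (absoluteGaloisGroup ℚ ⧸ (absGaloisRestrict ℚ K).range)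
  -- every `τ` normalises `res(Γ_K)` (`K/ℚ` Galois) and acts on `X` by the right translation `q ↦ qτ⁻¹`
  have hτn : ∀ τ : absoluteGaloisGroup ℚ,
      τ ∈ Subgroup.normalizer ((absGaloisRestrict ℚ K).range : Set (absoluteGaloisGroup ℚ)) := fun τ =>
    mem_normalizer_of_smul_absEmbedding K (smul_absEmbedding_eq_absGaloisQuot ℚ K τ)
  let n : absoluteGaloisGroup ℚ → (Subgroup.normalizer ((absGaloisRestrict ℚ K).range : Set (absoluteGaloisGroup ℚ))).op :=
    fun τ => ⟨MulOpposite.op τ⁻¹, op_inv_mem_normalizer_op (hτn τ)⟩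
  let r : absoluteGaloisGroup ℚ → Equiv.Perm (absoluteGaloisGroup ℚ ⧸ (absGaloisRestrict ℚ K).range) :=
    fun τ => MulAction.toPerm (n τ)
  have hr : ∀ (τ : absoluteGaloisGroup ℚ) (x : absoluteGaloisGroup ℚ ⧸ (absGaloisRestrict ℚ K).range),
      r τ (c • x) = c • r τ x := fun τ x => normalizerOp_smul_smul (hτn τ) c x
  have himage : ∀ (τ : absoluteGaloisGroup ℚ) (Ψ : Set (absoluteGaloisGroup ℚ ⧸ (absGaloisRestrict ℚ K).range)),
      r τ '' Ψ = translateType τ Ψ := fun τ Ψ => (translateType_eq_image_smul (hτn τ) Ψ).symm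
  have hb' : ∀ (τ : absoluteGaloisGroup ℚ) (Ψ : Set (absoluteGaloisGroup ℚ ⧸ (absGaloisRestrict ℚ K).range)),
      IsCMTypeWith c Ψ → (fun Φ => Additive.ofMul (e Φ σ)) (r τ '' Ψ) =
        MonoidHom.toAdditive (finiteClassGal K (absGaloisQuot ℚ K τ)) ((fun Φ => Additive.ofMul (e Φ σ)) Ψ) := by
    intro τ Ψ hΨ
    simp only [himage τ Ψ, hb τ Ψ hΨ, MonoidHom.toAdditive_apply_apply, toMul_ofMul]
  have hreach : ∀ x : absoluteGaloisGroup ℚ ⧸ (absGaloisRestrict ℚ K).range, ∃ τ : absoluteGaloisGroup ℚ,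
      r τ ((1 : absoluteGaloisGroup ℚ) : absoluteGaloisGroup ℚ ⧸ (absGaloisRestrict ℚ K).range) = x := by
    intro x
    obtain ⟨g, rfl⟩ := QuotientGroup.mk_surjective x
    refine ⟨g⁻¹, ?_⟩
    change n g⁻¹ • ((1 : absoluteGaloisGroup ℚ) : absoluteGaloisGroup ℚ ⧸ (absGaloisRestrict ℚ K).range) = _
    rw [normalizerOp_smul_coe (hτn g⁻¹) 1, inv_inv, one_mul]
  have h0 : (fun Φ => Additive.ofMul (e Φ σ))
      (Ψ₀ ∆ {r 1 ((1 : absoluteGaloisGroup ℚ) : absoluteGaloisGroup ℚ ⧸ (absGaloisRestrict ℚ K).range),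
        c • r 1 ((1 : absoluteGaloisGroup ℚ) : absoluteGaloisGroup ℚ ⧸ (absGaloisRestrict ℚ K).range)}) =
      (fun Φ => Additive.ofMul (e Φ σ)) Ψ₀ := by
    have hr1 : r 1 ((1 : absoluteGaloisGroup ℚ) : absoluteGaloisGroup ℚ ⧸ (absGaloisRestrict ℚ K).range) =
        ((1 : absoluteGaloisGroup ℚ) : absoluteGaloisGroup ℚ ⧸ (absGaloisRestrict ℚ K).range) := by
      change n 1 • ((1 : absoluteGaloisGroup ℚ) : absoluteGaloisGroup ℚ ⧸ (absGaloisRestrict ℚ K).range) = _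
      rw [normalizerOp_smul_coe (hτn 1) 1, inv_one, mul_one]
    rw [hr1]
    exact congrArg Additive.ofMul h1
  have h := hΨ₀.apply_eq_apply_of_pairDefect_eq_zero_of_transitive (G := absoluteGaloisGroup ℚ) hg
    (he.forall_two_smul_ofMul_apply σ) r hr (fun τ => MonoidHom.toAdditive (finiteClassGal K (absGaloisQuot ℚ K τ)))
    hb' hreach h0 hΨ hΨ'
  exact Additive.ofMul.injective h

end Galois

/-! ### §4. The junction with row A3-G49: sign representatives of the pair defect and the norm property -/

section NormProperty

omit [IsCMField K] he in
/-- The class of `con_{K/K⁺}((s))` is trivial for `s ∈ K⁺^×`. [cite: Milne2007FundamentalCM, §4.4 («μ₂(𝔸_{f,F})/μ₂(F)»)] -/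
private theorem mk_finiteIdeleConorm_unitEmbedding' (s : (maximalRealSubfield K)ˣ) :
    (QuotientGroup.mk (finiteIdeleConorm (maximalRealSubfield K) K
        (FiniteAdeleRing.unitEmbedding (𝓞 (maximalRealSubfield K)) (maximalRealSubfield K) s)) :
      (FiniteAdeleRing (𝓞 K) K)ˣ ⧸ (FiniteAdeleRing.unitEmbedding (𝓞 K) K).range) = 1 := by
  rw [QuotientGroup.eq_one_iff, finiteIdeleConorm_unitEmbedding]
  exact ⟨_, rfl⟩

variable {Ψ : Set (absoluteGaloisGroup ℚ ⧸ (absGaloisRestrict ℚ K).range)} (hΨ : IsCMTypeWith c Ψ)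
include hΨ

/-- **The pair defect is represented by a sign idèle of `F = K⁺`**: `e_Ψ(σ)/e_{Ψ ∆ {x, cx}}(σ) = con(ε)·K^×` with
`ε_v = ±1` for all `v` (the quotient of the two sign representatives of row A3-G48 §6 — «`e_Φ(σ) ∈ μ₂(𝔸_{f,F})/μ₂(F)`»).
[cite: Milne2007FundamentalCM, §4.4 («Let e ∈ μ₂(𝔸_{f,F}) … be a representative»)] -/
theorem exists_sign_div_apply_symmDiff_pair (σ : absoluteGaloisGroup ℚ)
    (x : absoluteGaloisGroup ℚ ⧸ (absGaloisRestrict ℚ K).range) :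
    ∃ ε : (FiniteAdeleRing (𝓞 (maximalRealSubfield K)) (maximalRealSubfield K))ˣ,
      (∀ v : HeightOneSpectrum (𝓞 (maximalRealSubfield K)),
        (ε : FiniteAdeleRing (𝓞 (maximalRealSubfield K)) (maximalRealSubfield K)) v = 1 ∨
          (ε : FiniteAdeleRing (𝓞 (maximalRealSubfield K)) (maximalRealSubfield K)) v = -1) ∧
      e Ψ σ / e (Ψ ∆ {x, c • x}) σ = QuotientGroup.mk (finiteIdeleConorm (maximalRealSubfield K) K ε) := by
  obtain ⟨ε₁, hε₁, h₁⟩ := he.exists_forall_apply_eq_one_or_eq_neg_one hΨ σ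
  obtain ⟨ε₂, hε₂, h₂⟩ := he.exists_forall_apply_eq_one_or_eq_neg_one (hΨ.symmDiff_pair x) σ
  refine ⟨ε₁ * ε₂⁻¹, fun v => ?_, ?_⟩
  · have hinv : ((ε₂⁻¹ : (FiniteAdeleRing (𝓞 (maximalRealSubfield K)) (maximalRealSubfield K))ˣ) :
        FiniteAdeleRing (𝓞 (maximalRealSubfield K)) (maximalRealSubfield K)) v =
          ((ε₂ : (FiniteAdeleRing (𝓞 (maximalRealSubfield K)) (maximalRealSubfield K))ˣ) :
            FiniteAdeleRing (𝓞 (maximalRealSubfield K)) (maximalRealSubfield K)) v := by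
      -- a sign is its own inverse: `ε₂² = 1` componentwise
      have hsq : ((ε₂ : (FiniteAdeleRing (𝓞 (maximalRealSubfield K)) (maximalRealSubfield K))ˣ) :
          FiniteAdeleRing (𝓞 (maximalRealSubfield K)) (maximalRealSubfield K)) v *
            ((ε₂ : (FiniteAdeleRing (𝓞 (maximalRealSubfield K)) (maximalRealSubfield K))ˣ) :
              FiniteAdeleRing (𝓞 (maximalRealSubfield K)) (maximalRealSubfield K)) v = 1 := by
        rcases hε₂ v with h | h <;> rw [h] <;> simp
      have hmul : ((ε₂⁻¹ : (FiniteAdeleRing (𝓞 (maximalRealSubfield K)) (maximalRealSubfield K))ˣ) :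
          FiniteAdeleRing (𝓞 (maximalRealSubfield K)) (maximalRealSubfield K)) v *
            ((ε₂ : (FiniteAdeleRing (𝓞 (maximalRealSubfield K)) (maximalRealSubfield K))ˣ) :
              FiniteAdeleRing (𝓞 (maximalRealSubfield K)) (maximalRealSubfield K)) v = 1 := by
        rw [← Literature.NumberTheory.Automorphic.FiniteAdeleRing.mul_apply', Units.inv_mul]
        rfl
      have hne : ((ε₂ : (FiniteAdeleRing (𝓞 (maximalRealSubfield K)) (maximalRealSubfield K))ˣ) :
          FiniteAdeleRing (𝓞 (maximalRealSubfield K)) (maximalRealSubfield K)) v ≠ 0 := by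
        rcases hε₂ v with h | h <;> rw [h] <;> simp
      exact mul_right_cancel₀ hne (hmul.trans hsq.symm)
    rw [Units.val_mul, Literature.NumberTheory.Automorphic.FiniteAdeleRing.mul_apply', hinv]
    rcases hε₁ v with h | h <;> rcases hε₂ v with h' | h' <;> rw [h, h'] <;> simp
  · rw [h₁, h₂, map_mul, map_inv, QuotientGroup.mk_mul, QuotientGroup.mk_inv, div_eq_mul_inv]

/-- **The pair defect is trivial under the norm property** («`e^F(σ) = Nm_{F′/F} e^{F′}(σ)` … This being true for every
pair `(ℓ₁, ℓ₂)`, we have `e_q = 1`»): if every sign representative `ε` of `e_Ψ(σ)/e_{Ψ ∆ {x,cx}}(σ)` is, modulo `F^×`, a norm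
of a sign idèle from every totally real quadratic `M/F`, then `e_{Ψ ∆ {x, cx}}(σ) = e_Ψ(σ)` (row A3-G49's
`(ℓ₁, ℓ₂)`-argument `exists_eq_unitEmbedding_of_forall_quadratic_mk`). [cite: Milne2007FundamentalCM, §4.4] -/
theorem apply_symmDiff_pair_eq_of_norm_property (σ : absoluteGaloisGroup ℚ)
    (x : absoluteGaloisGroup ℚ ⧸ (absGaloisRestrict ℚ K).range)
    (H : ∀ ε : (FiniteAdeleRing (𝓞 (maximalRealSubfield K)) (maximalRealSubfield K))ˣ,
      (∀ v : HeightOneSpectrum (𝓞 (maximalRealSubfield K)),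
        (ε : FiniteAdeleRing (𝓞 (maximalRealSubfield K)) (maximalRealSubfield K)) v = 1 ∨
          (ε : FiniteAdeleRing (𝓞 (maximalRealSubfield K)) (maximalRealSubfield K)) v = -1) →
      e Ψ σ / e (Ψ ∆ {x, c • x}) σ = QuotientGroup.mk (finiteIdeleConorm (maximalRealSubfield K) K ε) →
      ∀ (M : Type) [Field M] [NumberField M] [Algebra (maximalRealSubfield K) M],
        Module.finrank (maximalRealSubfield K) M = 2 → IsTotallyReal M →
        ∃ ε' : (FiniteAdeleRing (𝓞 M) M)ˣ,
          (∀ w : HeightOneSpectrum (𝓞 M), (ε' : FiniteAdeleRing (𝓞 M) M) w = 1 ∨ (ε' : FiniteAdeleRing (𝓞 M) M) w = -1) ∧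
            (QuotientGroup.mk ε : (FiniteAdeleRing (𝓞 (maximalRealSubfield K)) (maximalRealSubfield K))ˣ ⧸
                (FiniteAdeleRing.unitEmbedding (𝓞 (maximalRealSubfield K)) (maximalRealSubfield K)).range) =
              QuotientGroup.mk (finiteIdeleRelNorm (maximalRealSubfield K) M ε')) :
    e (Ψ ∆ {x, c • x}) σ = e Ψ σ := by
  obtain ⟨ε, hε, heq⟩ := he.exists_sign_div_apply_symmDiff_pair hΨ σ x
  obtain ⟨s, -, hs⟩ := exists_eq_unitEmbedding_of_forall_quadratic_mk ε hε (H ε hε heq)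
  rw [hs, mk_finiteIdeleConorm_unitEmbedding', div_eq_one] at heq
  exact heq.symm

end NormProperty

/-! ### §5. Assembled: the norm property at the pair defects ⟹ «`e_Φ(σ)` depends only on `σ`» -/

section Assembled

variable {σ : absoluteGaloisGroup ℚ} (hg : RespectsRelations c (fun Ψ => Additive.ofMul (e Ψ σ)))
  {Ψ₀ : Set (absoluteGaloisGroup ℚ ⧸ (absGaloisRestrict ℚ K).range)} (hΨ₀ : IsCMTypeWith c Ψ₀)
include hg hΨ₀

/-- **«`e_q = 1` … and so, for `Φ` a CM-type, `e_Φ(σ)` depends only on `σ`»** — any CM field `K`: if `e` satisfies (g) at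
`σ` and the sign representatives of EVERY pair defect `e_{Ψ₀}(σ)/e_{Ψ₀ ∆ {x,cx}}(σ)` have the norm property from every totally
real quadratic `M/K⁺` (Milne's consequence of (f)), then `e_Ψ(σ) = e_{Ψ′}(σ)` for all CM types `Ψ, Ψ′`.
[cite: Milne2007FundamentalCM, §4.4] -/
theorem apply_eq_apply_of_norm_property
    (H : ∀ (x : absoluteGaloisGroup ℚ ⧸ (absGaloisRestrict ℚ K).range)
      (ε : (FiniteAdeleRing (𝓞 (maximalRealSubfield K)) (maximalRealSubfield K))ˣ),
      (∀ v : HeightOneSpectrum (𝓞 (maximalRealSubfield K)),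
        (ε : FiniteAdeleRing (𝓞 (maximalRealSubfield K)) (maximalRealSubfield K)) v = 1 ∨
          (ε : FiniteAdeleRing (𝓞 (maximalRealSubfield K)) (maximalRealSubfield K)) v = -1) →
      e Ψ₀ σ / e (Ψ₀ ∆ {x, c • x}) σ = QuotientGroup.mk (finiteIdeleConorm (maximalRealSubfield K) K ε) →
      ∀ (M : Type) [Field M] [NumberField M] [Algebra (maximalRealSubfield K) M],
        Module.finrank (maximalRealSubfield K) M = 2 → IsTotallyReal M →
        ∃ ε' : (FiniteAdeleRing (𝓞 M) M)ˣ,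
          (∀ w : HeightOneSpectrum (𝓞 M), (ε' : FiniteAdeleRing (𝓞 M) M) w = 1 ∨ (ε' : FiniteAdeleRing (𝓞 M) M) w = -1) ∧
            (QuotientGroup.mk ε : (FiniteAdeleRing (𝓞 (maximalRealSubfield K)) (maximalRealSubfield K))ˣ ⧸
                (FiniteAdeleRing.unitEmbedding (𝓞 (maximalRealSubfield K)) (maximalRealSubfield K)).range) =
              QuotientGroup.mk (finiteIdeleRelNorm (maximalRealSubfield K) M ε'))
    {Ψ Ψ' : Set (absoluteGaloisGroup ℚ ⧸ (absGaloisRestrict ℚ K).range)} (hΨ : IsCMTypeWith c Ψ)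
    (hΨ' : IsCMTypeWith c Ψ') : e Ψ σ = e Ψ' σ :=
  he.apply_eq_apply_of_forall_pair hg hΨ₀ (fun x => he.apply_symmDiff_pair_eq_of_norm_property hΨ₀ σ x (H x)) hΨ hΨ'

/-- **The same for `K/ℚ` Galois with the printed (b): the norm property of the SINGLE class `e_{1+ι}(σ)`** (the pair
defect at the base point `1·res(Γ_K)`) from every totally real quadratic `M/K⁺` gives `e_Ψ(σ) = e_{Ψ′}(σ)` for all CM
types — Milne's «we can take `e(σ) = e_{1+ι}(σ)` … `e^F(σ) = Nm_{F′/F} e^{F′}(σ)` … we have `e_q = 1` … `e_Φ(σ)` depends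
only on `σ`». [cite: Milne2007FundamentalCM, §4.4] [cite: Deligne1982MotifsTaniyama, (F.6)] -/
theorem apply_eq_apply_of_norm_property_of_isGalois [IsGalois ℚ K]
    (hb : ∀ (τ : absoluteGaloisGroup ℚ) (Ψ : Set (absoluteGaloisGroup ℚ ⧸ (absGaloisRestrict ℚ K).range)),
      IsCMTypeWith c Ψ → e (translateType τ Ψ) σ = finiteClassGal K (absGaloisQuot ℚ K τ) (e Ψ σ))
    (H : ∀ ε : (FiniteAdeleRing (𝓞 (maximalRealSubfield K)) (maximalRealSubfield K))ˣ,
      (∀ v : HeightOneSpectrum (𝓞 (maximalRealSubfield K)),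
        (ε : FiniteAdeleRing (𝓞 (maximalRealSubfield K)) (maximalRealSubfield K)) v = 1 ∨
          (ε : FiniteAdeleRing (𝓞 (maximalRealSubfield K)) (maximalRealSubfield K)) v = -1) →
      e Ψ₀ σ / e (Ψ₀ ∆ {((1 : absoluteGaloisGroup ℚ) : absoluteGaloisGroup ℚ ⧸ (absGaloisRestrict ℚ K).range),
        c • ((1 : absoluteGaloisGroup ℚ) : absoluteGaloisGroup ℚ ⧸ (absGaloisRestrict ℚ K).range)}) σ =
        QuotientGroup.mk (finiteIdeleConorm (maximalRealSubfield K) K ε) →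
      ∀ (M : Type) [Field M] [NumberField M] [Algebra (maximalRealSubfield K) M],
        Module.finrank (maximalRealSubfield K) M = 2 → IsTotallyReal M →
        ∃ ε' : (FiniteAdeleRing (𝓞 M) M)ˣ,
          (∀ w : HeightOneSpectrum (𝓞 M), (ε' : FiniteAdeleRing (𝓞 M) M) w = 1 ∨ (ε' : FiniteAdeleRing (𝓞 M) M) w = -1) ∧
            (QuotientGroup.mk ε : (FiniteAdeleRing (𝓞 (maximalRealSubfield K)) (maximalRealSubfield K))ˣ ⧸
                (FiniteAdeleRing.unitEmbedding (𝓞 (maximalRealSubfield K)) (maximalRealSubfield K)).range) =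
              QuotientGroup.mk (finiteIdeleRelNorm (maximalRealSubfield K) M ε'))
    {Ψ Ψ' : Set (absoluteGaloisGroup ℚ ⧸ (absGaloisRestrict ℚ K).range)} (hΨ : IsCMTypeWith c Ψ)
    (hΨ' : IsCMTypeWith c Ψ') : e Ψ σ = e Ψ' σ :=
  he.apply_eq_apply_of_pair_base_of_isGalois hg hΨ₀ hb
    (he.apply_symmDiff_pair_eq_of_norm_property hΨ₀ σ _ H) hΨ hΨ'

end Assembled

end IsTaniyamaDefect

end Literature.NumberTheory.ComplexMultiplication

end
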